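import Summits.QuantumFields.YangMills.Theorems.OnsetSkewLawRPOnsetFloorCrossFloorDatum
import HarnessLib

/-!
# Cruxes `OnsetSkewLaw.RPOnsetFloor` (stmt-QuantumFields-23138) and `MarkovAtoms.OnsetFloor` (stmt-QuantumFields-22956), LINES
# «FemtoWitness» (planner ym-idea-11 g14; skeletons `g14/femto-witness.lean` v2 sha 958e4afc / `g14/markov-femto-witness.lean`
# sha a576d52f): the registered stub B `stub_atomicCross` BY NAME

Stub B of both FemtoWitness lines (IDENTICAL text): an ATOMIC torus floor — one affine image `v = b(κ · − w)` of an admissible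
collar bump with `κ s ≤ 1`, `κ s ≤ 2 w₀`, `R₀ + 1 + 10 κ s ≤ 2 w₀ + t` and the torus two-point floor `ε ≤ Q2(θv, v)` at resolution
`s` — is an atomic CROSS floor `CrossQAt G` (= the tree's `RPOnsetFloorCoarseCollar.CrossFloorDatum G`, verbatim) in every
odd-torus limit state.  Proof (`atomicCross_core`, every compact `G`): `OSPigeonhole.coneCrossFloor_of_torusFloor` (S1 + S2a, ✓ tree)
gives `ε ≤ Cov_μ(B′_{v,s}∘Θ, A_{v,s})` with `A_{v,s} = Σ_q Σ'_x v(sx)·P_q(x)` (`smear_eq_sum_tsum_plane`) and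
`B′_{v,s} = Σ_q Σ'_x v(s(x + ℓ_q))·P_q(x)` (`smearR`); the single-atom identities `v(s x) = b((κs)(x + o_q) − (w + (κs) o_q))` and
`v(s(x + ℓ_q)) = b((κs)(x + o_q) − (w + (κs)(o_q − ℓ_q)))` exhibit both fields as ONE `b`-atom per orientation (families indexed by
`{q // q.1 < q.2}`, coefficients `1`, `K = 7`, spacing floor `κ s`); the per-atom clauses are the hypotheses `0 ≤ w₀`, `κ s ≤ 2w₀`,
`R₀ + 1 + 10 κ s ≤ 2w₀ + t` and `(o_q)₀ − ℓ_q,₀ ∈ [−1/2, 0]` (`centreOffset_zero_sub_layerShift`).  Then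
`stub_atomicCross : StubAtomicCrossP` (registered text verbatim; `AtomicTorusFloorAt`, `CrossQAt` copied verbatim, `AdmBump` the tree
copy of `RPOnsetFloorCellShift`).

HONEST FRAMING: glue stub of two OPEN lines; their residual `SqueezedSkewness.FemtoTwoPointUnit` (stmt-QuantumFields-23679, XL) and
stub A `stub_femtoAtomicFloor` are untouched; no crux, rung or summit is proved; the Yang–Mills mass gap is NOT proved.  Cell
`ym-idea-1`, width seat `ym-line-sfw-p2-w5` g16 (free hands). [folklore]
-/

set_option autoImplicit false

noncomputable section

open scoped BigOperators
open MeasureTheory ProbabilityTheory Filter Topology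
open Literature.MathematicalPhysics.QuantumFieldTheory Literature.MathematicalPhysics.QuantumLattice
open Literature.Probability.LatticeModels (Site)
open Summit.QuantumFields.YangMills.Cruxes.OSLegsFromFemtoAndGap.DlrCollarTransfer (Q2 plane)
open Summit.QuantumFields.YangMills.Theorems.InfiniteVolume (stateMomentStr summable_abs_schwartz_lattice)
open Summit.QuantumFields.YangMills.Theorems.InfVolRP (centreOffset centreOffset_time)
open Summit.QuantumFields.YangMills.Theorems.RPOnsetFloorCellShift (AdmBump)
open Summit.QuantumFields.YangMills.Theorems.OnsetSkewLawRPOnsetFloorOSPigeonhole (smear smearR layerShift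
  smear_eq_sum_tsum_plane coneCrossFloor_of_torusFloor)
open Summit.QuantumFields.YangMills.Theorems.RPOnsetFloorCoarseCollar (siteToE_add_eq centreOffset_zero_sub_layerShift)

namespace Summit.QuantumFields.YangMills.Theorems.RPOnsetFloorAtomicCross

/-! ## §0 Registered texts (verbatim from the FemtoWitness skeletons; registered-stub copies, not citable facts) -/

/-- ATOMIC TORUS FLOOR for the datum `(G, r)` (verbatim the skeletons' `AtomicTorusFloorAt`). -/
abbrev AtomicTorusFloorAt (G : Type) [Group G] [TopologicalSpace G] [IsTopologicalGroup G] [CompactSpace G]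
    [MeasurableSpace G] [BorelSpace G] (r : LatticeRep G) : Prop :=
  ∃ (b : SchwartzMap (EuclideanSpace ℝ (Fin 4)) ℝ) (R₀ t : ℝ), AdmBump b R₀ t ∧
    ∃ (v : SchwartzMap (EuclideanSpace ℝ (Fin 4)) ℝ) (κ : ℝ) (w : EuclideanSpace ℝ (Fin 4)),
      0 < κ ∧ 0 ≤ w 0 ∧ (∀ u : EuclideanSpace ℝ (Fin 4), v u = b (κ • u - w)) ∧
      tsupport (v : EuclideanSpace ℝ (Fin 4) → ℝ) ⊆ {u : EuclideanSpace ℝ (Fin 4) | 0 < u 0} ∧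
      ∃ (ε Λ₅ β₅ : ℝ), 0 < ε ∧ ∀ β : ℝ, β₅ ≤ β →
        ∃ s : ℝ, 0 < s ∧ κ * s ≤ 1 ∧ κ * s ≤ 2 * w 0 ∧ R₀ + 1 + 10 * (κ * s) ≤ 2 * w 0 + t ∧
          ∀ L : ℕ, Λ₅ ≤ s * L → ε ≤ Q2 G r β L s (thetaTest 4 v) v

/-- ATOMIC CROSS FLOOR for `G` (verbatim the skeletons' `CrossQAt`; textually the tree's `RPOnsetFloorCoarseCollar.CrossFloorDatum`). -/
abbrev CrossQAt (G : Type) [Group G] [TopologicalSpace G] [IsTopologicalGroup G] [CompactSpace G]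
    [MeasurableSpace G] [BorelSpace G] : Prop :=
      ∃ (r : LatticeRep G) (b : SchwartzMap (EuclideanSpace ℝ (Fin 4)) ℝ) (R₀ t ε₀ K : ℝ), AdmBump b R₀ t ∧ 0 < ε₀ ∧ 0 < K ∧
        ∃ β₅ : ℝ, ∀ β : ℝ, β₅ ≤ β → ∀ μ ∈ oddTorusLimitPoints r β,
          ∃ s : ℝ, 0 < s ∧
          ∃ (ι : Type) (_ : Countable ι) (a : ι → ℝ) (q : ι → Fin 4 × Fin 4) (sI : ι → ℝ) (y : ι → EuclideanSpace ℝ (Fin 4))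
            (ι' : Type) (_ : Countable ι') (a' : ι' → ℝ) (q' : ι' → Fin 4 × Fin 4) (sI' : ι' → ℝ)
            (y' : ι' → EuclideanSpace ℝ (Fin 4)),
            Summable (fun i => |a i|) ∧ ∑' i, |a i| ≤ K ∧ Summable (fun j => |a' j|) ∧ ∑' j, |a' j| ≤ K ∧
            (∀ i, (q i).1 < (q i).2 ∧ s ≤ sI i ∧ -(sI i / 2) ≤ y i 0 ∧
              (sI i ≤ 1 → 0 ≤ y i 0 ∧ R₀ + 1 + 9 * sI i ≤ 2 * y i 0 + t)) ∧
            (∀ j, (q' j).1 < (q' j).2 ∧ s ≤ sI' j ∧ -(sI' j / 2) ≤ y' j 0 ∧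
              (sI' j ≤ 1 → 0 ≤ y' j 0 ∧ R₀ + 1 + 9 * sI' j ≤ 2 * y' j 0 + t)) ∧
            ε₀ ≤ cov[fun U => ∑' j, a' j *
                      (∑' x : Fin 4 → ℤ, b (sI' j • (siteToE x + centreOffset (q' j)) - y' j) * plane G r (q' j) x (cfgReflect U)),
                    fun U => ∑' i, a i *
                      (∑' x : Fin 4 → ℤ, b (sI i • (siteToE x + centreOffset (q i)) - y i) * plane G r (q i) x U); μ]

/-- STUB B statement (verbatim the skeletons' `StubAtomicCrossP`). -/
abbrev StubAtomicCrossP : Prop :=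
  ∀ (G : Type) [Group G] [TopologicalSpace G] [IsTopologicalGroup G] [CompactSpace G],
    IsCompactSimpleLieGroup G → Nonempty (G ≃ₜ* Matrix.specialUnitaryGroup (Fin 2) ℂ) →
    letI : MeasurableSpace G := borel G
    haveI : BorelSpace G := ⟨rfl⟩
    ∀ r : LatticeRep G, AtomicTorusFloorAt G r → CrossQAt G

/-! ## §1 The single-atom identities -/

/-- `A`-side: `κ(sX) − w = (κs)(X + c) − (w + (κs)c)`. [folklore] -/
theorem single_atom_arg_A (κ s : ℝ) (X c w : EuclideanSpace ℝ (Fin 4)) :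
    κ • (s • X) - w = (κ * s) • (X + c) - (w + (κ * s) • c) := by
  ext j
  simp only [PiLp.sub_apply, PiLp.add_apply, PiLp.smul_apply, smul_eq_mul]
  ring

/-- `B′`-side: `κ(s(X + L)) − w = (κs)(X + c) − (w + (κs)(c − L))`. [folklore] -/
theorem single_atom_arg_B (κ s : ℝ) (X c L w : EuclideanSpace ℝ (Fin 4)) :
    κ • (s • (X + L)) - w = (κ * s) • (X + c) - (w + (κ * s) • (c - L)) := by
  ext j
  simp only [PiLp.sub_apply, PiLp.add_apply, PiLp.smul_apply, smul_eq_mul]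
  ring

/-! ## §2 Stub B for every compact `G` -/

/-- **Atomic torus floor ⇒ atomic cross floor**, for every compact `G` with its Borel structure. [folklore] -/
theorem atomicCross_core {G : Type} [Group G] [TopologicalSpace G] [IsTopologicalGroup G] [CompactSpace G]
    [MeasurableSpace G] [BorelSpace G] (r : LatticeRep G) (h : AtomicTorusFloorAt G r) : CrossQAt G := by
  obtain ⟨b, R₀, t, hb, v, κ, w, hκ, hw0, hvb, hv, ε, Λ₅, β₅, hε, hβ⟩ := h
  refine ⟨r, b, R₀, t, ε, (Fintype.card {q : Fin 4 × Fin 4 // q.1 < q.2} : ℝ) + 1, hb, hε, by positivity, β₅,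
    fun β hβ' μ hμ => ?_⟩
  obtain ⟨s, hs, hκs1, hκsw, hcol, hfl⟩ := hβ β hβ'
  have hκs : 0 < κ * s := mul_pos hκ hs
  -- the cone cross floor (S1 + S2a)
  have hcone := (coneCrossFloor_of_torusFloor G r hs v hv hfl hμ).1
  -- the single-atom expansions of `A_{v,s}` and `B′_{v,s}`
  have hA : smear G r (v : EuclideanSpace ℝ (Fin 4) → ℝ) s = fun U =>
      ∑' q : {q : Fin 4 × Fin 4 // q.1 < q.2}, (1 : ℝ) *
        (∑' x : Fin 4 → ℤ, b ((κ * s) • (siteToE x + centreOffset q.1) - (w + (κ * s) • centreOffset q.1)) *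
          plane G r q.1 x U) := by
    funext U
    rw [smear_eq_sum_tsum_plane G r (summable_abs_schwartz_lattice v hs) U, tsum_fintype]
    refine Finset.sum_congr rfl fun q _ => ?_
    rw [one_mul]
    refine tsum_congr fun x => ?_
    rw [hvb, single_atom_arg_A κ s (siteToE x) (centreOffset q.1) w]
  have hB : smearR G r (v : EuclideanSpace ℝ (Fin 4) → ℝ) s = fun V =>
      ∑' q : {q : Fin 4 × Fin 4 // q.1 < q.2}, (1 : ℝ) *
        (∑' x : Fin 4 → ℤ, b ((κ * s) • (siteToE x + centreOffset q.1) -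
          (w + (κ * s) • (centreOffset q.1 - siteToE (layerShift q.1)))) * plane G r q.1 x V) := by
    funext V
    rw [smearR, tsum_fintype]
    refine Finset.sum_congr rfl fun q _ => ?_
    rw [one_mul]
    refine tsum_congr fun x => ?_
    rw [hvb, siteToE_add_eq, single_atom_arg_B κ s (siteToE x) (centreOffset q.1) (siteToE (layerShift q.1)) w]
  -- masses
  have hmass : ∑' _q : {q : Fin 4 × Fin 4 // q.1 < q.2}, |(1 : ℝ)| ≤
      (Fintype.card {q : Fin 4 × Fin 4 // q.1 < q.2} : ℝ) + 1 := by
    rw [tsum_fintype, Finset.sum_const, Finset.card_univ, abs_one, nsmul_eq_mul, mul_one]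
    linarith
  refine ⟨κ * s, hκs, {q : Fin 4 × Fin 4 // q.1 < q.2}, inferInstance,
    (fun _ => 1), (fun q => q.1), (fun _ => κ * s), (fun q => w + (κ * s) • centreOffset q.1),
    {q : Fin 4 × Fin 4 // q.1 < q.2}, inferInstance,
    (fun _ => 1), (fun q => q.1), (fun _ => κ * s), (fun q => w + (κ * s) • (centreOffset q.1 - siteToE (layerShift q.1))),
    Summable.of_finite, hmass, Summable.of_finite, hmass,
    fun q => ⟨q.2, le_rfl, ?_, ?_⟩, fun q => ⟨q.2, le_rfl, ?_, ?_⟩, ?_⟩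
  · have hc : 0 ≤ centreOffset q.1 0 := (centreOffset_time q.1).1
    have h0 : (w + (κ * s) • centreOffset q.1) 0 = w 0 + κ * s * centreOffset q.1 0 := by
      simp only [PiLp.add_apply, PiLp.smul_apply, smul_eq_mul]
    rw [h0]
    nlinarith [mul_nonneg hκs.le hc]
  · intro _
    have hc : 0 ≤ centreOffset q.1 0 := (centreOffset_time q.1).1
    have h0 : (w + (κ * s) • centreOffset q.1) 0 = w 0 + κ * s * centreOffset q.1 0 := by
      simp only [PiLp.add_apply, PiLp.smul_apply, smul_eq_mul]
    rw [h0]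
    constructor <;> nlinarith [mul_nonneg hκs.le hc]
  · have hc := centreOffset_zero_sub_layerShift q.2
    have h0 : (w + (κ * s) • (centreOffset q.1 - siteToE (layerShift q.1))) 0 =
        w 0 + κ * s * (centreOffset q.1 0 - siteToE (layerShift q.1) 0) := by
      simp only [PiLp.add_apply, PiLp.smul_apply, PiLp.sub_apply, smul_eq_mul]
    rw [h0]
    nlinarith [mul_le_mul_of_nonneg_left hc.1 hκs.le]
  · intro _
    have hc := centreOffset_zero_sub_layerShift q.2
    have h0 : (w + (κ * s) • (centreOffset q.1 - siteToE (layerShift q.1))) 0 =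
        w 0 + κ * s * (centreOffset q.1 0 - siteToE (layerShift q.1) 0) := by
      simp only [PiLp.add_apply, PiLp.smul_apply, PiLp.sub_apply, smul_eq_mul]
    rw [h0]
    constructor <;> nlinarith [mul_le_mul_of_nonneg_left hc.1 hκs.le, mul_le_mul_of_nonneg_left hc.2 hκs.le]
  · have hfloor := hcone
    rw [hA, hB] at hfloor
    exact hfloor

/-- **Stub B `stub_atomicCross` of the FemtoWitness lines, BY NAME** (the SU(2) hypotheses are idle: `atomicCross_core`). [folklore] -/
theorem stub_atomicCross : StubAtomicCrossP := by
  intro G _ _ _ _ _hG _hSU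
  letI : MeasurableSpace G := borel G
  haveI : BorelSpace G := ⟨rfl⟩
  intro r h
  exact atomicCross_core r h

end Summit.QuantumFields.YangMills.Theorems.RPOnsetFloorAtomicCross

end
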